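import Literature.Analysis.Complex.WeylLemmaDbar
import Mathlib.Topology.ContinuousMap.Bounded.Normed
import Mathlib.MeasureTheory.Integral.Bochner.ContinuousLinearMap
import HarnessLib

/-!
# Weyl's lemma for `∂/∂z̄`, functional form: a `∂̄`-closed order-zero distribution is holomorphic

The form consumed directly by weak-* limits of the lattice functionals of the parafermionic
observable (no Riesz–Markov theorem needed): the limit is a bounded linear functional `Λ` on
bounded continuous functions (after a cut-off), and the route's weak `∂̄`-closure says
`Λ(∂̄φ) = 0` for smooth compactly supported `φ`.

**Theorem (`weyl_dbar_ball_functional`).** Let `Λ : (ℂ →ᵇ ℂ) →L[ℂ] ℂ` satisfy `Λ(∂̄φ) = 0` for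
every smooth `φ : ℂ → ℂ` with compact support in `B(z₀, 3R)`. Then there is `g` holomorphic on
`B(z₀, 3R/2)` with `Λ(φ) = ∫ φ g dA` for every smooth `φ` compactly supported in `B(z₀, R)`
(Hörmander, *ALPDO I*, Thm. 4.4.1: hypoellipticity of `∂/∂z̄`; H. Weyl 1940). [folklore]

Proof: the Cauchy-transform argument of `Literature/Analysis/Complex/WeylLemmaDbar.lean`, with the
abstract functional in place of `∫ · f dA`. For a cut-off `χ` (`= 1` on `B̄(z₀, 2R)`, supported in
`B̄(z₀, 5R/2)`) and the Cauchy transform `ψ = K ⋆ φ` (`∂̄ψ = φ`, Hörmander Thm. 1.2.2), the test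
function `χψ` gives `Λ(φ) = -Λ(ψ ∂̄χ)`; the bounded continuous function `ψ ∂̄χ` is the Bochner
integral `∫ φ(w) • k_w dw` in `ℂ →ᵇ ℂ` of the family `k_w(z) = ∂̄χ(z) (π(z - w))⁻¹` (the kernel is
evaluated only at `|z - w| ≥ R/4`), `Λ` commutes with this integral
(`ContinuousLinearMap.integral_comp_comm`), so `Λ(φ) = ∫ φ g` with `g(w) = -Λ(k_w)`; and
`w ↦ k_w` is complex-differentiable into `ℂ →ᵇ ℂ` on `B(z₀, 3R/2)` (explicit second-order
remainder of `t ↦ 1/t`), whence `g = -Λ ∘ k` is holomorphic there.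
-/

noncomputable section

open MeasureTheory Set Filter Function Complex Metric BoundedContinuousFunction
open scoped Real Topology ContDiff

namespace Literature.Analysis.Complex

/-- The truncated Cauchy kernel `t ↦ conj t / (π max(|t|², c²))` is continuous. [folklore] -/
theorem continuous_truncKernel {c : ℝ} (hc : 0 < c) :
    Continuous fun t : ℂ => (starRingEnd ℂ) t / (↑π * ↑(max (‖t‖ ^ 2) (c ^ 2))) := by
  refine Complex.continuous_conj.div (continuous_const.mul (Complex.continuous_ofReal.comp
    ((continuous_norm.pow 2).max continuous_const))) fun t => ?_
  refine mul_ne_zero (ofReal_ne_zero.2 Real.pi_pos.ne') (ofReal_ne_zero.2 ?_)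
  exact (lt_of_lt_of_le (pow_pos hc 2) (le_max_right _ _)).ne'

/-- Off the disc `|t| < c` the truncated Cauchy kernel is the Cauchy kernel `(π t)⁻¹`. [folklore] -/
theorem truncKernel_eq {c : ℝ} (hc : 0 < c) {t : ℂ} (ht : c ≤ ‖t‖) :
    (starRingEnd ℂ) t / (↑π * ↑(max (‖t‖ ^ 2) (c ^ 2))) = (↑π * t)⁻¹ := by
  have ht0 : t ≠ 0 := by intro h; rw [h, norm_zero] at ht; linarith
  have hmax : max (‖t‖ ^ 2) (c ^ 2) = ‖t‖ ^ 2 := max_eq_left (pow_le_pow_left₀ hc.le ht 2)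
  rw [hmax, Complex.sq_norm, ← Complex.mul_conj]
  have hconj : (starRingEnd ℂ) t ≠ 0 := by simpa using ht0
  field_simp

/-- The truncated Cauchy kernel is bounded by `(π c)⁻¹`. [folklore] -/
theorem norm_truncKernel_le {c : ℝ} (hc : 0 < c) (t : ℂ) :
    ‖(starRingEnd ℂ) t / (↑π * ↑(max (‖t‖ ^ 2) (c ^ 2)))‖ ≤ π⁻¹ * c⁻¹ := by
  have hm : 0 < max (‖t‖ ^ 2) (c ^ 2) := lt_of_lt_of_le (pow_pos hc 2) (le_max_right _ _)
  rw [norm_div, Complex.norm_conj, norm_mul, Complex.norm_real, Complex.norm_real,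
    Real.norm_eq_abs, Real.norm_eq_abs, abs_of_pos Real.pi_pos, abs_of_pos hm, div_le_iff₀
    (by positivity)]
  rcases le_or_gt c ‖t‖ with h | h
  · have hmax : max (‖t‖ ^ 2) (c ^ 2) = ‖t‖ ^ 2 := max_eq_left (pow_le_pow_left₀ hc.le h 2)
    rw [hmax]
    have h1 : 1 ≤ c⁻¹ * ‖t‖ := by rw [← div_eq_inv_mul, one_le_div hc]; exact h
    have h2 : π⁻¹ * c⁻¹ * (π * ‖t‖ ^ 2) = (c⁻¹ * ‖t‖) * ‖t‖ := by field_simp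
    rw [h2]
    exact le_mul_of_one_le_left (norm_nonneg _) h1
  · have hmax : c ^ 2 ≤ max (‖t‖ ^ 2) (c ^ 2) := le_max_right _ _
    have : ‖t‖ ≤ π⁻¹ * c⁻¹ * (π * c ^ 2) := by
      rw [show π⁻¹ * c⁻¹ * (π * c ^ 2) = c by field_simp]; exact h.le
    calc ‖t‖ ≤ π⁻¹ * c⁻¹ * (π * c ^ 2) := this
      _ ≤ π⁻¹ * c⁻¹ * (π * max (‖t‖ ^ 2) (c ^ 2)) := by gcongr

/-- The truncated squared kernel `t ↦ conj t² / (π max(|t|⁴, c⁴))` is continuous. [folklore] -/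
theorem continuous_truncKernel_sq {c : ℝ} (hc : 0 < c) :
    Continuous fun t : ℂ => (starRingEnd ℂ) t ^ 2 / (↑π * ↑(max (‖t‖ ^ 4) (c ^ 4))) := by
  refine (Complex.continuous_conj.pow 2).div (continuous_const.mul
    (Complex.continuous_ofReal.comp ((continuous_norm.pow 4).max continuous_const))) fun t => ?_
  refine mul_ne_zero (ofReal_ne_zero.2 Real.pi_pos.ne') (ofReal_ne_zero.2 ?_)
  exact (lt_of_lt_of_le (pow_pos hc 4) (le_max_right _ _)).ne'

/-- Off the disc `|t| < c` the truncated squared kernel is `π⁻¹ t⁻²`. [folklore] -/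
theorem truncKernel_sq_eq {c : ℝ} (hc : 0 < c) {t : ℂ} (ht : c ≤ ‖t‖) :
    (starRingEnd ℂ) t ^ 2 / (↑π * ↑(max (‖t‖ ^ 4) (c ^ 4))) = (↑π)⁻¹ * (t ^ 2)⁻¹ := by
  have ht0 : t ≠ 0 := by intro h; rw [h, norm_zero] at ht; linarith
  have hmax : max (‖t‖ ^ 4) (c ^ 4) = ‖t‖ ^ 4 := max_eq_left (pow_le_pow_left₀ hc.le ht 4)
  have h4 : ((‖t‖ ^ 4 : ℝ) : ℂ) = (t * (starRingEnd ℂ) t) ^ 2 := by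
    rw [Complex.mul_conj, ← Complex.sq_norm]; push_cast; ring
  rw [hmax, h4]
  have hconj : (starRingEnd ℂ) t ≠ 0 := by simpa using ht0
  have hπ : (π : ℂ) ≠ 0 := ofReal_ne_zero.2 Real.pi_pos.ne'
  field_simp

/-- The truncated squared kernel is bounded by `(π c²)⁻¹`. [folklore] -/
theorem norm_truncKernel_sq_le {c : ℝ} (hc : 0 < c) (t : ℂ) :
    ‖(starRingEnd ℂ) t ^ 2 / (↑π * ↑(max (‖t‖ ^ 4) (c ^ 4)))‖ ≤ π⁻¹ * (c ^ 2)⁻¹ := by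
  have hm : 0 < max (‖t‖ ^ 4) (c ^ 4) := lt_of_lt_of_le (pow_pos hc 4) (le_max_right _ _)
  rw [norm_div, norm_pow, Complex.norm_conj, norm_mul, Complex.norm_real, Complex.norm_real,
    Real.norm_eq_abs, Real.norm_eq_abs, abs_of_pos Real.pi_pos, abs_of_pos hm, div_le_iff₀
    (by positivity)]
  rcases le_or_gt c ‖t‖ with h | h
  · have hmax : max (‖t‖ ^ 4) (c ^ 4) = ‖t‖ ^ 4 := max_eq_left (pow_le_pow_left₀ hc.le h 4)
    rw [hmax]
    have h2 : c ^ 2 ≤ ‖t‖ ^ 2 := pow_le_pow_left₀ hc.le h 2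
    have : ‖t‖ ^ 2 = π⁻¹ * (c ^ 2)⁻¹ * (π * (c ^ 2 * ‖t‖ ^ 2)) := by field_simp
    rw [this, show ‖t‖ ^ 4 = ‖t‖ ^ 2 * ‖t‖ ^ 2 by ring]
    gcongr
  · have : ‖t‖ ^ 2 ≤ c ^ 2 := pow_le_pow_left₀ (norm_nonneg _) h.le 2
    calc ‖t‖ ^ 2 ≤ c ^ 2 := this
      _ = π⁻¹ * (c ^ 2)⁻¹ * (π * c ^ 4) := by field_simp
      _ ≤ π⁻¹ * (c ^ 2)⁻¹ * (π * max (‖t‖ ^ 4) (c ^ 4)) := by gcongr; exact le_max_right _ _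

/-- **Weyl's lemma for `∂/∂z̄`, functional form (local).** Let `Λ` be a continuous linear
functional on the bounded continuous functions `ℂ →ᵇ ℂ` with `Λ(∂̄φ) = 0` for every smooth
`φ : ℂ → ℂ` compactly supported in `B(z₀, 3R)` (for any bounded continuous representative of
`∂̄φ`). Then there is `g` holomorphic on `B(z₀, 3R/2)` with `Λ(φ) = ∫ φ g dA` for every smooth `φ`
compactly supported in `B(z₀, R)` (Hörmander, *ALPDO I*, Thm. 4.4.1; H. Weyl 1940). [folklore] -/
theorem weyl_dbar_ball_functional (Λ : (ℂ →ᵇ ℂ) →L[ℂ] ℂ) {z₀ : ℂ} {R : ℝ} (hR : 0 < R)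
    (hyp : ∀ φ : ℂ → ℂ, ContDiff ℝ ∞ φ → HasCompactSupport φ → tsupport φ ⊆ ball z₀ (3 * R) →
      ∀ Φ : ℂ →ᵇ ℂ, (⇑Φ = dbarAlong 1 φ) → Λ Φ = 0) :
    ∃ g : ℂ → ℂ, DifferentiableOn ℂ g (ball z₀ (3 * R / 2)) ∧
      ∀ φ : ℂ → ℂ, ContDiff ℝ ∞ φ → HasCompactSupport φ → tsupport φ ⊆ ball z₀ R →
        ∀ Φ : ℂ →ᵇ ℂ, (⇑Φ = φ) → Λ Φ = ∫ z, φ z * g z := by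
  ---------------------------------------------------------------- the cut-off and `∂̄χ`
  let χ : ContDiffBump z₀ := ⟨2 * R, 5 * R / 2, by linarith, by linarith⟩
  set χc : ℂ → ℂ := fun z => ((χ z : ℝ) : ℂ) with hχc
  have hχc_smooth : ContDiff ℝ ∞ χc := contDiff_ofReal_comp χ.contDiff
  have hχc_diff : ∀ z, DifferentiableAt ℝ χc z := fun z =>
    (hχc_smooth.differentiable (by simp)).differentiableAt
  have hχc_one : ∀ z ∈ closedBall z₀ (2 * R), χc z = 1 := fun z hz => by
    simp [hχc, χ.one_of_mem_closedBall (show z ∈ closedBall z₀ χ.rIn from hz)]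
  have hχc_supp : tsupport χc ⊆ closedBall z₀ (5 * R / 2) := by
    refine (tsupport_ofReal_comp_subset χ).trans ?_
    rw [χ.tsupport_eq]
  have hχc_cpt : HasCompactSupport χc := χ.hasCompactSupport.comp_left ofReal_zero
  obtain ⟨dχ, hdχ⟩ : ∃ dχ : ℂ → ℂ, dχ = dbarAlong 1 χc := ⟨_, rfl⟩
  have hdχ_cont : Continuous dχ := by
    have hc : Continuous (fderiv ℝ χc) := hχc_smooth.continuous_fderiv (by simp)
    have : dχ = fun z => (2 : ℂ)⁻¹ • (fderiv ℝ χc z 1 + I • fderiv ℝ χc z I) := by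
      ext z; rw [hdχ, dbarAlong_one]
    rw [this]
    exact ((hc.clm_apply continuous_const).add
      ((hc.clm_apply continuous_const).const_smul I)).const_smul ((2 : ℂ)⁻¹)
  have hdχ_zero_in : ∀ z ∈ ball z₀ (2 * R), dχ z = 0 := fun z hz => by
    rw [hdχ]
    exact dbarAlong_eq_zero_of_eventuallyEq_const (c := 1) (by
      filter_upwards [isOpen_ball.mem_nhds hz] with w hw
      exact hχc_one w (ball_subset_closedBall hw))
  have hdχ_zero_out : ∀ z, z ∉ closedBall z₀ (5 * R / 2) → dχ z = 0 := fun z hz => by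
    rw [hdχ]
    exact dbarAlong_eq_zero_of_notMem_tsupport fun h' => hz (hχc_supp h')
  have hdχ_cpt : HasCompactSupport dχ := HasCompactSupport.intro (isCompact_closedBall _ _) hdχ_zero_out
  obtain ⟨B, hB⟩ := hdχ_cont.bounded_above_of_compact_support hdχ_cpt
  have hB0 : 0 ≤ B := (norm_nonneg _).trans (hB z₀)
  -- geometry: where `∂̄χ ≠ 0`, the kernel variable stays away from `0`
  have hfar : ∀ z, dχ z ≠ 0 → ∀ w ∈ ball z₀ (7 * R / 4), R / 4 ≤ ‖z - w‖ := by
    intro z hz w hw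
    have hz2 : 2 * R ≤ dist z z₀ := by
      by_contra h'; exact hz (hdχ_zero_in z (mem_ball.2 (lt_of_not_ge h')))
    rw [mem_ball] at hw
    have := dist_triangle z w z₀
    simp only [dist_eq_norm] at this hw hz2
    linarith
  have hfar' : ∀ z, dχ z ≠ 0 → ∀ w ∈ ball z₀ (3 * R / 2), R / 2 ≤ ‖z - w‖ := by
    intro z hz w hw
    have hz2 : 2 * R ≤ dist z z₀ := by
      by_contra h'; exact hz (hdχ_zero_in z (mem_ball.2 (lt_of_not_ge h')))
    rw [mem_ball] at hw
    have := dist_triangle z w z₀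
    simp only [dist_eq_norm] at this hw hz2
    linarith
  ---------------------------------------------------------------- the family `k w ∈ ℂ →ᵇ ℂ`
  have hc4 : 0 < R / 4 := by positivity
  have hk_cont : ∀ w, Continuous fun z =>
      dχ z * ((starRingEnd ℂ) (z - w) / (↑π * ↑(max (‖z - w‖ ^ 2) ((R / 4) ^ 2)))) := fun w =>
    hdχ_cont.mul ((continuous_truncKernel hc4).comp (continuous_id.sub continuous_const))
  have hk_bdd : ∀ w z, ‖dχ z * ((starRingEnd ℂ) (z - w) /
      (↑π * ↑(max (‖z - w‖ ^ 2) ((R / 4) ^ 2))))‖ ≤ B * (π⁻¹ * (R / 4)⁻¹) := fun w z => by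
    rw [norm_mul]
    exact mul_le_mul (hB z) (norm_truncKernel_le hc4 _) (norm_nonneg _) hB0
  have hk'_cont : ∀ w, Continuous fun z =>
      dχ z * ((starRingEnd ℂ) (z - w) ^ 2 / (↑π * ↑(max (‖z - w‖ ^ 4) ((R / 4) ^ 4)))) := fun w =>
    hdχ_cont.mul ((continuous_truncKernel_sq hc4).comp (continuous_id.sub continuous_const))
  have hk'_bdd : ∀ w z, ‖dχ z * ((starRingEnd ℂ) (z - w) ^ 2 /
      (↑π * ↑(max (‖z - w‖ ^ 4) ((R / 4) ^ 4))))‖ ≤ B * (π⁻¹ * ((R / 4) ^ 2)⁻¹) := fun w z => by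
    rw [norm_mul]
    exact mul_le_mul (hB z) (norm_truncKernel_sq_le hc4 _) (norm_nonneg _) hB0
  let k : ℂ → (ℂ →ᵇ ℂ) := fun w => ofNormedAddCommGroup _ (hk_cont w) _ (hk_bdd w)
  let k' : ℂ → (ℂ →ᵇ ℂ) := fun w => ofNormedAddCommGroup _ (hk'_cont w) _ (hk'_bdd w)
  have hk_apply : ∀ w ∈ ball z₀ (7 * R / 4), ∀ z, k w z = dχ z * (↑π * (z - w))⁻¹ := by
    intro w hw z
    show dχ z * ((starRingEnd ℂ) (z - w) / (↑π * ↑(max (‖z - w‖ ^ 2) ((R / 4) ^ 2)))) = _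
    by_cases hz : dχ z = 0
    · simp [hz]
    · rw [truncKernel_eq hc4 (hfar z hz w hw)]
  have hk'_apply : ∀ w ∈ ball z₀ (7 * R / 4), ∀ z,
      k' w z = dχ z * ((↑π)⁻¹ * ((z - w) ^ 2)⁻¹) := by
    intro w hw z
    show dχ z * ((starRingEnd ℂ) (z - w) ^ 2 / (↑π * ↑(max (‖z - w‖ ^ 4) ((R / 4) ^ 4)))) = _
    by_cases hz : dχ z = 0
    · simp [hz]
    · rw [truncKernel_sq_eq hc4 (hfar z hz w hw)]
  ---------------------------------------------------------------- `w ↦ k w` is holomorphic on `B(z₀, 3R/2)`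
  have hkderiv : ∀ w ∈ ball z₀ (3 * R / 2), HasDerivAt k (k' w) w := by
    intro w hw
    have hw74 : w ∈ ball z₀ (7 * R / 4) := ball_subset_ball (by linarith) hw
    set C : ℝ := B * (π⁻¹ * (((R / 2) ^ 2)⁻¹ * (R / 4)⁻¹)) with hC
    have hC0 : 0 ≤ C := by rw [hC]; positivity
    -- the second-order remainder bound, valid for `‖η‖ < R/4`
    have hrem : ∀ η : ℂ, ‖η‖ < R / 4 → ‖k (w + η) - k w - η • k' w‖ ≤ C * ‖η‖ ^ 2 := by
      intro η hη
      have hwη : w + η ∈ ball z₀ (7 * R / 4) := by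
        rw [mem_ball, dist_eq_norm] at hw ⊢
        calc ‖w + η - z₀‖ = ‖(w - z₀) + η‖ := by ring_nf
          _ ≤ ‖w - z₀‖ + ‖η‖ := norm_add_le _ _
          _ < 3 * R / 2 + R / 4 := by linarith
          _ = 7 * R / 4 := by ring
      refine (BoundedContinuousFunction.norm_le (by positivity)).2 fun z => ?_
      rw [BoundedContinuousFunction.sub_apply, BoundedContinuousFunction.sub_apply,
        BoundedContinuousFunction.smul_apply, hk_apply _ hwη, hk_apply _ hw74, hk'_apply _ hw74,
        smul_eq_mul]
      by_cases hz : dχ z = 0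
      · simp [hz]; positivity
      · have ha : R / 2 ≤ ‖z - w‖ := hfar' z hz w hw
        have haη : R / 4 ≤ ‖z - (w + η)‖ := hfar z hz (w + η) hwη
        have ha0 : z - w ≠ 0 := by
          intro h0; rw [h0, norm_zero] at ha; linarith
        have haη0 : z - (w + η) ≠ 0 := by
          intro h0; rw [h0, norm_zero] at haη; linarith
        have hπ : (π : ℂ) ≠ 0 := ofReal_ne_zero.2 Real.pi_pos.ne'
        have hid : dχ z * (↑π * (z - (w + η)))⁻¹ - dχ z * (↑π * (z - w))⁻¹ -
            η * (dχ z * ((↑π)⁻¹ * ((z - w) ^ 2)⁻¹)) =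
            dχ z * ((↑π)⁻¹ * (η ^ 2 * (((z - w) ^ 2)⁻¹ * (z - (w + η))⁻¹))) := by
          field_simp
          ring
        rw [hid, norm_mul, norm_mul, norm_mul, norm_mul, norm_inv, norm_inv, norm_inv, norm_pow,
          norm_pow, Complex.norm_real, Real.norm_eq_abs, abs_of_pos Real.pi_pos, hC]
        have h1 : ((‖z - w‖ ^ 2)⁻¹ : ℝ) ≤ ((R / 2) ^ 2)⁻¹ :=
          inv_anti₀ (by positivity) (pow_le_pow_left₀ (by positivity) ha 2)
        have h2 : (‖z - (w + η)‖⁻¹ : ℝ) ≤ (R / 4)⁻¹ := inv_anti₀ (by positivity) haη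
        calc ‖dχ z‖ * (π⁻¹ * (‖η‖ ^ 2 * ((‖z - w‖ ^ 2)⁻¹ * ‖z - (w + η)‖⁻¹)))
            ≤ B * (π⁻¹ * (‖η‖ ^ 2 * (((R / 2) ^ 2)⁻¹ * (R / 4)⁻¹))) := by
              gcongr
              exact hB z
          _ = B * (π⁻¹ * (((R / 2) ^ 2)⁻¹ * (R / 4)⁻¹)) * ‖η‖ ^ 2 := by ring
    rw [hasDerivAt_iff_isLittleO_nhds_zero, Asymptotics.isLittleO_iff]
    intro c hc
    have hrad : 0 < min (R / 4) (c / (C + 1)) := lt_min (by positivity) (by positivity)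
    filter_upwards [Metric.ball_mem_nhds (0 : ℂ) hrad] with η hη
    rw [mem_ball, dist_zero_right] at hη
    have hη1 : ‖η‖ < R / 4 := hη.trans_le (min_le_left _ _)
    have hη2 : ‖η‖ < c / (C + 1) := hη.trans_le (min_le_right _ _)
    calc ‖k (w + η) - k w - η • k' w‖ ≤ C * ‖η‖ ^ 2 := hrem η hη1
      _ = (C * ‖η‖) * ‖η‖ := by ring
      _ ≤ c * ‖η‖ := by
          refine mul_le_mul_of_nonneg_right ?_ (norm_nonneg _)
          have : C * ‖η‖ ≤ C * (c / (C + 1)) := mul_le_mul_of_nonneg_left hη2.le hC0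
          have hCc : C * (c / (C + 1)) ≤ c := by
            rw [mul_div_assoc']
            rw [div_le_iff₀ (by positivity)]
            nlinarith
          linarith
  have hg_hol : DifferentiableOn ℂ (fun w => -Λ (k w)) (ball z₀ (3 * R / 2)) := fun w hw =>
    ((Λ.hasFDerivAt.comp_hasDerivAt w (hkderiv w hw)).neg).differentiableAt.differentiableWithinAt
  refine ⟨fun w => -Λ (k w), hg_hol, fun φ hφ hφc hφs Φ hΦ => ?_⟩
  ---------------------------------------------------------------- the Cauchy transform and the test function `χψ`
  have hφ1 : ContDiff ℝ 1 φ := hφ.of_le (by exact_mod_cast le_top)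
  have hφ_cont : Continuous φ := hφ.continuous
  obtain ⟨Bφ, hBφ⟩ := hφ_cont.bounded_above_of_compact_support hφc
  set ψ : ℂ → ℂ := fun z : ℂ => ∫ t : ℂ, (↑π * t)⁻¹ • φ (z - t) with hψ
  have hψ_smooth : ContDiff ℝ ∞ ψ := contDiff_cauchyTransform hφ hφc
  have hψ_diff : ∀ z, DifferentiableAt ℝ ψ z := fun z =>
    (hψ_smooth.differentiable (by simp)).differentiableAt
  have hψ_dbar : ∀ z, dbarAlong 1 ψ z = φ z := fun z => dbarAlong_one_cauchyTransform hφ1 hφc z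
  set Φ₁ : ℂ → ℂ := fun z => χc z * ψ z with hΦ₁
  have hΦ₁_smooth : ContDiff ℝ ∞ Φ₁ := hχc_smooth.mul hψ_smooth
  have hΦ₁_cpt : HasCompactSupport Φ₁ := hχc_cpt.mul_right
  have hΦ₁_supp : tsupport Φ₁ ⊆ ball z₀ (3 * R) :=
    ((tsupport_mul_subset_left (f := χc) (g := ψ)).trans hχc_supp).trans
      (closedBall_subset_ball (by linarith))
  have hΦ₁_dbar : ∀ z, dbarAlong 1 Φ₁ z = dχ z * ψ z + φ z := fun z => by
    rw [show dbarAlong 1 Φ₁ z = dbarAlong 1 (fun w => χc w * ψ w) z from rfl,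
      dbarAlong_one_mul (hχc_diff z) (hψ_diff z), hψ_dbar, hdχ]
    by_cases hz : z ∈ tsupport φ
    · rw [hχc_one z (closedBall_subset_closedBall (by linarith)
        (ball_subset_closedBall (hφs hz))), one_mul]
    · rw [image_eq_zero_of_notMem_tsupport hz, mul_zero]
  -- `Ψ = ψ ∂̄χ` and `φ` as bounded continuous functions
  have hΨ_cont : Continuous fun z => dχ z * ψ z := hdχ_cont.mul hψ_smooth.continuous
  have hΨ_cpt : HasCompactSupport fun z => dχ z * ψ z := hdχ_cpt.mul_right
  obtain ⟨BΨ, hBΨ⟩ := hΨ_cont.bounded_above_of_compact_support hΨ_cpt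
  obtain ⟨Ψ, hΨ⟩ : ∃ Ψ : ℂ →ᵇ ℂ, ∀ z, Ψ z = dχ z * ψ z :=
    ⟨ofNormedAddCommGroup (fun z => dχ z * ψ z) hΨ_cont BΨ hBΨ, fun z => rfl⟩
  have hΦφ : ∀ z, Φ z = φ z := fun z => by rw [hΦ]
  have h0 : Λ Ψ + Λ Φ = 0 := by
    rw [← map_add]
    refine hyp Φ₁ hΦ₁_smooth hΦ₁_cpt hΦ₁_supp (Ψ + Φ) ?_
    ext z
    simp only [BoundedContinuousFunction.coe_add, Pi.add_apply, hΨ z, hΦφ z, hΦ₁_dbar z]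
  ---------------------------------------------------------------- `Ψ = ∫ φ(w) • k w dw` in `ℂ →ᵇ ℂ`
  obtain ⟨Bf, hBf⟩ : ∃ Bf : ℂ → (ℂ →ᵇ ℂ), ∀ w, Bf w = φ w • k w := ⟨fun w => φ w • k w, fun w => rfl⟩
  have hBf_cont : Continuous Bf := by
    refine continuous_iff_continuousAt.2 fun w => ?_
    have hBf' : Bf = fun w => φ w • k w := funext hBf
    by_cases hw : w ∈ ball z₀ (3 * R / 2)
    · rw [hBf']; exact hφ_cont.continuousAt.smul (hkderiv w hw).continuousAt
    · have hw' : w ∉ tsupport φ := fun h' => hw (ball_subset_ball (by linarith) (hφs h'))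
      have hev : Bf =ᶠ[𝓝 w] fun _ => 0 := by
        have : φ =ᶠ[𝓝 w] 0 := by rwa [← notMem_tsupport_iff_eventuallyEq]
        filter_upwards [this] with y hy
        rw [hBf, hy, Pi.zero_apply, zero_smul]
      exact continuousAt_const.congr hev.symm
  have hBf_cpt : HasCompactSupport Bf := by
    rw [show Bf = fun w => φ w • k w from funext hBf]; exact hφc.smul_right
  have hBf_int : Integrable Bf := hBf_cont.integrable_of_hasCompactSupport hBf_cpt
  have hψw : ∀ z, ψ z = ∫ w, (↑π * (z - w))⁻¹ * φ w := fun z => by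
    rw [hψ]
    simp only [smul_eq_mul]
    rw [← integral_sub_left_eq_self (fun w => (↑π * (z - w))⁻¹ * φ w) volume z]
    congr 1
    ext t
    simp
  have hint_eq : ∫ w, Bf w = Ψ := by
    ext z
    have h1 := ((BoundedContinuousFunction.evalCLM ℂ z).integral_comp_comm hBf_int).symm
    simp only [BoundedContinuousFunction.evalCLM_apply] at h1
    rw [h1]
    rw [hΨ z, hψw z, ← integral_const_mul]
    refine integral_congr_ae (Eventually.of_forall fun w => ?_)
    show Bf w z = dχ z * ((↑π * (z - w))⁻¹ * φ w)
    rw [hBf, BoundedContinuousFunction.smul_apply, smul_eq_mul]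
    by_cases hw : w ∈ ball z₀ (7 * R / 4)
    · rw [hk_apply w hw]; ring
    · have hw' : w ∉ tsupport φ := fun h' => hw (ball_subset_ball (by linarith) (hφs h'))
      rw [image_eq_zero_of_notMem_tsupport hw']; simp
  ---------------------------------------------------------------- conclusion
  have hΛΨ : Λ Ψ = -∫ w, φ w * (-Λ (k w)) := by
    rw [← hint_eq, ← Λ.integral_comp_comm hBf_int, ← integral_neg]
    refine integral_congr_ae (Eventually.of_forall fun w => ?_)
    show Λ (Bf w) = -(φ w * -Λ (k w))
    rw [hBf, map_smul, smul_eq_mul]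
    ring
  have : Λ Φ = -Λ Ψ := by linear_combination h0
  rw [this, hΛΨ, neg_neg]

end Literature.Analysis.Complex

end
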